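import Summits.ABC.IUTFork.Conditional.WRowHexLamSevenTwelveAllLevels
import Summits.ABC.IUTFork.Conditional.WRowHexLamSevenThirteenAllLevels
import Summits.ABC.IUTFork.Conditional.WRowHexLamSevenFourteenAllLevels
import Summits.ABC.IUTFork.Conditional.AbcOfSGenuineKLicence
import Summits.ABC.IUTFork.Cor312ThetaSideClosedK
import Summits.ABC.IUTFork.Cor312SettingDHVolWitness
import Summits.ABC.IUTFork.Cor312ProvKIdeles
import HarnessLib

/-!
# Branch C — the NUMBER-LEVEL typed [IUTchIII] Cor. 3.12 in READING (U) (`T.Cor312Of`) TRUE, NO hypothesis, at EVERY genuine Θ-volume datum over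
# the HEX points `λ_k = ½ + 2/7^k`, `k = 12, 13, 14`, UNIFORMLY IN `l` on their INHABITED half-axes (`l ≥ 20071 / 5857 / 46957`)

C scoreboard (abc-iut-C-cert-3 gen 5, INTAKE / CERTS pen). PROOF-ONLY junction file (no `def`, no new `Prop`, no instance, no notation; nothing
re-typed); part B of `AbcOfSCor312OfHexBands` (p498110, k ≤ 11) / `AbcOfSCor312OfInhBands` (p508961, k = 10), SAME recipe and words:
`<licence theorem> ∘ GenuineK.cor312Of_of_licence (p435505) ∘ negLogTheta_settingPrVolSharp_pilotDataOfK_le_datum (p447368)` at one-point context data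
(`unitSigDH/unitSplitDH/unitQDataDH/unitLatticeDH`, `M := ℚ`), realising ideles `Cor312Prov.exists_realising_{q,theta}Ideles_pilotDataOfK`.
Inputs BY NAME: abc-iut-C-cert-1 g8's «W:HEX-AXIS-REST» (I) licences `WRow.licence_lamSeven_twelve_all` (p510844) / `…_thirteen_all` (p511838) /
`…_fourteen_all` (p512701) (gen_hex.py of the w5-d107 lineage; W-row-1's slot socket). Their REF halves `GenuineK.not_pilotKummerCompatHull_chosen_lamSeven_<k>_le`
(11 ≤ l ≤ 20063 / 5851 / 46933; p510341 / p511835 / p512703) make each axis two-sided.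

READING (numbers, no side): on each inhabited half-axis the window certificates' number-binder instance (K, LINE-FREE) is a THEOREM at every genuine
datum; NO height bound follows (known λ, log q ≪ the content locus); cone binder untouched (C-R52); records UNCHANGED; non-emptiness / admissibility /
(P6) along the bands NOT claimed (the tabulated HEX levels are ≤ 137); inhabited-as-typed ≠ true-in-print; typed ≠ proved; instantiated ≠ endorsed;
not a claim that abc is proved or refuted; no side taken on [IUTchIII] Cor 3.12 / [IUTchIV] Thm 1.10 or on any author.
[cite: Mochizuki2012, IUTchIII Cor. 3.12 p. 173–174, Step (xi-f) p. 184; IUTchIV Thm. 1.10 p. 22–23, Cor. 2.2 (ii) proof (P5)(P7) p. 46; IUTchI Ex. 3.2 (iv) p. 71]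
[cite: DupuyHilado2025, §3.3, §3.4] [claim: Mochizuki2012, status: disputed]
-/

noncomputable section

open Set Function NumberField IsDedekindDomain

namespace Summit.ABC.IUTFork.Conditional

open Thm311 Thm311.Real Cor312 Cor312Vol Cor312Prov Literature.IUT.LogThetaLattice Literature.IUT.LogVolume
  Literature.IUT.HodgeTheaters Literature.IUT.LogVolume.ThetaData Literature.IUT.LogVolume.Cor22
open Literature.NumberTheory.NumberFields Literature.NumberTheory.GaloisRepresentations.Ultrametric
open Literature.NumberTheory.DiophantineGeometry Literature.NumberTheory.DiophantineGeometry.GenEll Summit.ABC.ABC.Theorems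

/-- **`T.Cor312Of` at EVERY genuine Θ-volume datum over the HEX point `λ_12 = ½ + 2/7^12` (`k = 12`) for EVERY prime `l ≥ 20071`, NO
hypothesis** — abc-iut-C-cert-1 g8's «W:HEX-AXIS-REST» (I) licence `WRow.licence_lamSeven_twelve_all` (p510844) through `GenuineK.cor312Of_of_licence`
(p435505) + the Θ-descent p447368 (REF half: every prime `11 ≤ l ≤ 20063`). [cite: Mochizuki2012, IUTchIII Cor. 3.12 p. 173–174; IUTchIV Cor. 2.2 (ii)
proof (P5) p. 46] [claim: Mochizuki2012, status: disputed] -/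
theorem Hex.cor312Of_lamSeven_twelve_all {k l : ℕ} (hk : k = 12) (hl : l.Prime) (hl0 : 20071 ≤ l)
    (T : Cor22.ThetaVolumeDatumAt (ratPoint ((2 : ℚ)⁻¹ + 2 / 7 ^ k)) l) : T.Cor312Of := by
  letI := T.instFieldF; letI := T.instNumberFieldF; letI := T.instAlgebraF; letI := T.instFieldK
  letI := T.instNumberFieldK; letI := T.instAlgebraK; letI := T.instFieldFbar; letI := T.instAlgebraFbar
  letI := T.instAlgebraKFbar; letI := T.instIsElliptic
  obtain ⟨tq, htq0, htq1, htq⟩ := exists_realising_qIdeles_pilotDataOfK T.D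
  obtain ⟨t, ht0, ht1, ht⟩ := exists_realising_thetaIdeles_pilotDataOfK T.D
  exact GenuineK.cor312Of_of_licence T.D T.K ℚ (fun _ _ => ∅) (fun _ _ => ∅) (fun _ _ _ => ∅) (fun _ _ _ => 0) (fun _ _ => ∅)
    (fun _ _ _ _ => ∅) 0 unitLatticeDH (unitSigDH (pilotDataOfK T.D T.K)) (unitSplitDH (pilotDataOfK T.D T.K))
    (unitQDataDH (pilotDataOfK T.D T.K)) t tq T.isVolumeInputOf htq0 htq1 ht0 ht1 htq
    (WRow.licence_lamSeven_twelve_all hk hl hl0 T (logvAnalytic_analyticLogv (F := T.K)) ℚ (fun _ _ => ∅) (fun _ _ => ∅) (fun _ _ _ => ∅)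
      (fun _ _ _ => 0) (fun _ _ => ∅) (fun _ _ _ _ => ∅) 0 unitLatticeDH (unitSigDH (pilotDataOfK T.D T.K)) (unitSplitDH (pilotDataOfK T.D T.K))
      (unitQDataDH (pilotDataOfK T.D T.K)) tq t htq0 htq1 ht0 ht htq)
    (negLogTheta_settingPrVolSharp_pilotDataOfK_le_datum T ℚ (fun _ _ => ∅) (fun _ _ => ∅) (fun _ _ _ => ∅) (fun _ _ _ => 0) (fun _ _ => ∅)
      (fun _ _ _ _ => ∅) 0 unitLatticeDH (unitSigDH (pilotDataOfK T.D T.K)) (unitSplitDH (pilotDataOfK T.D T.K)) (unitQDataDH (pilotDataOfK T.D T.K))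
      tq t htq0 htq1 ht0 ht)

/-- **`T.Cor312Of` at EVERY genuine Θ-volume datum over the HEX point `λ_13 = ½ + 2/7^13` (`k = 13`) for EVERY prime `l ≥ 5857`, NO
hypothesis** — abc-iut-C-cert-1 g8's «W:HEX-AXIS-REST» (I) licence `WRow.licence_lamSeven_thirteen_all` (p511838) through `GenuineK.cor312Of_of_licence`
(p435505) + the Θ-descent p447368 (REF half: every prime `11 ≤ l ≤ 5851`). [cite: Mochizuki2012, IUTchIII Cor. 3.12 p. 173–174; IUTchIV Cor. 2.2 (ii)
proof (P5) p. 46] [claim: Mochizuki2012, status: disputed] -/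
theorem Hex.cor312Of_lamSeven_thirteen_all {k l : ℕ} (hk : k = 13) (hl : l.Prime) (hl0 : 5857 ≤ l)
    (T : Cor22.ThetaVolumeDatumAt (ratPoint ((2 : ℚ)⁻¹ + 2 / 7 ^ k)) l) : T.Cor312Of := by
  letI := T.instFieldF; letI := T.instNumberFieldF; letI := T.instAlgebraF; letI := T.instFieldK
  letI := T.instNumberFieldK; letI := T.instAlgebraK; letI := T.instFieldFbar; letI := T.instAlgebraFbar
  letI := T.instAlgebraKFbar; letI := T.instIsElliptic
  obtain ⟨tq, htq0, htq1, htq⟩ := exists_realising_qIdeles_pilotDataOfK T.D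
  obtain ⟨t, ht0, ht1, ht⟩ := exists_realising_thetaIdeles_pilotDataOfK T.D
  exact GenuineK.cor312Of_of_licence T.D T.K ℚ (fun _ _ => ∅) (fun _ _ => ∅) (fun _ _ _ => ∅) (fun _ _ _ => 0) (fun _ _ => ∅)
    (fun _ _ _ _ => ∅) 0 unitLatticeDH (unitSigDH (pilotDataOfK T.D T.K)) (unitSplitDH (pilotDataOfK T.D T.K))
    (unitQDataDH (pilotDataOfK T.D T.K)) t tq T.isVolumeInputOf htq0 htq1 ht0 ht1 htq
    (WRow.licence_lamSeven_thirteen_all hk hl hl0 T (logvAnalytic_analyticLogv (F := T.K)) ℚ (fun _ _ => ∅) (fun _ _ => ∅) (fun _ _ _ => ∅)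
      (fun _ _ _ => 0) (fun _ _ => ∅) (fun _ _ _ _ => ∅) 0 unitLatticeDH (unitSigDH (pilotDataOfK T.D T.K)) (unitSplitDH (pilotDataOfK T.D T.K))
      (unitQDataDH (pilotDataOfK T.D T.K)) tq t htq0 htq1 ht0 ht htq)
    (negLogTheta_settingPrVolSharp_pilotDataOfK_le_datum T ℚ (fun _ _ => ∅) (fun _ _ => ∅) (fun _ _ _ => ∅) (fun _ _ _ => 0) (fun _ _ => ∅)
      (fun _ _ _ _ => ∅) 0 unitLatticeDH (unitSigDH (pilotDataOfK T.D T.K)) (unitSplitDH (pilotDataOfK T.D T.K)) (unitQDataDH (pilotDataOfK T.D T.K))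
      tq t htq0 htq1 ht0 ht)

/-- **`T.Cor312Of` at EVERY genuine Θ-volume datum over the HEX point `λ_14 = ½ + 2/7^14` (`k = 14`) for EVERY prime `l ≥ 46957`, NO
hypothesis** — abc-iut-C-cert-1 g8's «W:HEX-AXIS-REST» (I) licence `WRow.licence_lamSeven_fourteen_all` (p512701) through `GenuineK.cor312Of_of_licence`
(p435505) + the Θ-descent p447368 (REF half: every prime `11 ≤ l ≤ 46933`). [cite: Mochizuki2012, IUTchIII Cor. 3.12 p. 173–174; IUTchIV Cor. 2.2 (ii)
proof (P5) p. 46] [claim: Mochizuki2012, status: disputed] -/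
theorem Hex.cor312Of_lamSeven_fourteen_all {k l : ℕ} (hk : k = 14) (hl : l.Prime) (hl0 : 46957 ≤ l)
    (T : Cor22.ThetaVolumeDatumAt (ratPoint ((2 : ℚ)⁻¹ + 2 / 7 ^ k)) l) : T.Cor312Of := by
  letI := T.instFieldF; letI := T.instNumberFieldF; letI := T.instAlgebraF; letI := T.instFieldK
  letI := T.instNumberFieldK; letI := T.instAlgebraK; letI := T.instFieldFbar; letI := T.instAlgebraFbar
  letI := T.instAlgebraKFbar; letI := T.instIsElliptic
  obtain ⟨tq, htq0, htq1, htq⟩ := exists_realising_qIdeles_pilotDataOfK T.D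
  obtain ⟨t, ht0, ht1, ht⟩ := exists_realising_thetaIdeles_pilotDataOfK T.D
  exact GenuineK.cor312Of_of_licence T.D T.K ℚ (fun _ _ => ∅) (fun _ _ => ∅) (fun _ _ _ => ∅) (fun _ _ _ => 0) (fun _ _ => ∅)
    (fun _ _ _ _ => ∅) 0 unitLatticeDH (unitSigDH (pilotDataOfK T.D T.K)) (unitSplitDH (pilotDataOfK T.D T.K))
    (unitQDataDH (pilotDataOfK T.D T.K)) t tq T.isVolumeInputOf htq0 htq1 ht0 ht1 htq
    (WRow.licence_lamSeven_fourteen_all hk hl hl0 T (logvAnalytic_analyticLogv (F := T.K)) ℚ (fun _ _ => ∅) (fun _ _ => ∅) (fun _ _ _ => ∅)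
      (fun _ _ _ => 0) (fun _ _ => ∅) (fun _ _ _ _ => ∅) 0 unitLatticeDH (unitSigDH (pilotDataOfK T.D T.K)) (unitSplitDH (pilotDataOfK T.D T.K))
      (unitQDataDH (pilotDataOfK T.D T.K)) tq t htq0 htq1 ht0 ht htq)
    (negLogTheta_settingPrVolSharp_pilotDataOfK_le_datum T ℚ (fun _ _ => ∅) (fun _ _ => ∅) (fun _ _ _ => ∅) (fun _ _ _ => 0) (fun _ _ => ∅)
      (fun _ _ _ _ => ∅) 0 unitLatticeDH (unitSigDH (pilotDataOfK T.D T.K)) (unitSplitDH (pilotDataOfK T.D T.K)) (unitQDataDH (pilotDataOfK T.D T.K))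
      tq t htq0 htq1 ht0 ht)

end Summit.ABC.IUTFork.Conditional

end
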